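import Mathlib
import Summits.NavierStokesRegularity.NavierStokesRegularity.Theorems.TaoLadderRungThreeRestartControl
import Summits.NavierStokesRegularity.NavierStokesRegularity.Theses.BarrierStepRungThree
import HarnessLib

/-!
# `BarrierStepRungThree.RestartControl` (item stmt-NavierStokesRegularity-23422, re-wanted verbatim)

The support `RestartControl` of route `BarrierStepRungThree` is, character for character, the
shared support `RestartControl` of routes `TaoLadderRungThree` / `TrappingWindowRungThree` /
`ExactWindowRungThree` (items stmt-NavierStokesRegularity-20424 / 21750), proved in the tree as
`Theorems.RestartControl.main` (file `TaoLadderRungThreeRestartControl.lean`): Tao's scale covariance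
at a checkpoint — restarted flows of a global pseudo-solution are `(η,η)`-pseudo-flows with
admissible slack for levels `n₀ ≥ N₀(K₁, K₂)`. This file closes the new item by that theorem.

HONEST FRAMING: bookkeeping about Tao-type MODEL lattice ODEs; nothing about Navier–Stokes.
-/

noncomputable section

set_option linter.dupNamespace false

namespace Summit.NavierStokesRegularity.NavierStokesRegularity.Theorems

open RestartControl in
/-- **Item stmt-NavierStokesRegularity-23422** (`BarrierStepRungThree.RestartControl`): Tao's scale
covariance at a checkpoint with small defects and admissible slack, closed by the tree theorem
`RestartControl.main`. [cite: Tao2016AveragedNS, §6.4 Prop. 6.5 and Lemma 6.7] -/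
theorem barrierStepRungThree_restartControl_proof :
    Summit.NavierStokesRegularity.NavierStokesRegularity.Theses.BarrierStepRungThree.RestartControl := by
  unfold Summit.NavierStokesRegularity.NavierStokesRegularity.Theses.BarrierStepRungThree.RestartControl
  intro ε₀ θ c η i₀ α X₀ P env K₁ K₂ hε₀ hθ hc hη hX₀ hK₁ hK₂
  exact main hε₀ hθ hc hη hX₀ hK₁ hK₂

end Summit.NavierStokesRegularity.NavierStokesRegularity.Theorems

end
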